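import Summits.RiemannHypothesis.RiemannHypothesis.Theses.TotalPositivity
import Literature.NumberTheory.LFunctions.KatkovaPF44Proofs
import Literature.NumberTheory.DiophantineGeometry.NamedHypothesesRHProofs

/-!
# RiemannHypothesis / TotalPositivity — the thesis `TpThesis` is the summit (bookkeeping)

Route `RiemannHypothesis/TotalPositivity`, item `stmt-RiemannHypothesis-0301`, target decl
`Summit.RiemannHypothesis.RiemannHypothesis.Theses.TotalPositivity.TpThesis`: every minor of the
lower-triangular Toeplitz matrix of `aₙ := γ(n)/n!` (`γ = Literature.NumberTheory.LFunctions.xiTaylorCoeff`,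
`Σ γ(n) z^{2n}/n! = 8 ξ(1/2 + z)`) is `≥ 0`, i.e. `(aₙ)` is a Pólya frequency sequence.

This file does NOT settle the item. It records, against the route decl verbatim, what the tree
already knows about it (all inputs are theorems of the tree, nothing is assumed):

* `tpThesis_iff_riemannHypothesis` — `TpThesis ↔ Summit.RiemannHypothesis`: the item is the
  summit, restated (Katkova 2006, §1 Thm. C and the sentence after it, discharged in the tree as
  `Literature.NumberTheory.LFunctions.katkova_rh_iff_pf_holds`, whose right-hand side is the body
  of `TpThesis` character for character).
* `tpThesis_iff_isPolyaFrequencySeq`, `tpThesis_iff_forall_isMultiplyPositiveSeq` —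
  `TpThesis ↔ (aₙ) ∈ PF_∞ ↔ ∀ m, (aₙ) ∈ PF_m` in the vocabulary of
  `Literature/Analysis/TotalPositivity`.
* `tpThesis_iff_forall_riemannHypothesisUpTo` — `TpThesis ↔ ∀ T, RiemannHypothesisUpTo T`:
  the open content of the item is exactly the passage to the limit `T → ∞` in the numerical
  verifications of RH.
* `tpThesis_order_of_riemannHypothesisUpTo` — the finite approximants: RH up to height `T`
  gives every minor of order `k` with `k + 1 ≤ π T` (Katkova's remark after Thm. 1, via
  Schoenberg's sector theorem; `isMultiplyPositiveSeq_xi_of_riemannHypothesisUpTo`), and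
  `tpThesis_order_le_fortyNine` — unconditionally every minor of order `k ≤ 49`
  (`isMultiplyPositiveSeq_xi_fortyNine`, from the kernel-checked `riemannHypothesisUpTo_sixteen`).
* `tpThesis_iff_not_tpNegativeCertificate` — the Σ₁ negative side of the route is literally
  `¬ TpThesis` (hence `¬ RH`).

## References

* O. M. Katkova, *Multiple positivity and the Riemann zeta-function*, CMFT 7 (2007) 13–31;
  arXiv:math/0505174, §1 Thm. C, Thm. 1 and the remark following it. [Katkova2006]
* I. J. Schoenberg, Rend. Circ. Mat. Palermo (2) 4 (1955) 123–131 (Theorem B). [Schoenberg1955]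
-/

noncomputable section

namespace Summit.RiemannHypothesis.TotalPositivity

open Literature.NumberTheory.LFunctions Literature.Analysis.TotalPositivity
open Literature.NumberTheory.DiophantineGeometry
open Summit.RiemannHypothesis.RiemannHypothesis.Theses.TotalPositivity
open scoped Nat

/-- **The thesis of route TotalPositivity is the summit**: `TpThesis ↔ RiemannHypothesis`.
The body of `TpThesis` is verbatim the right-hand side of Katkova's equivalence
`katkova_rh_iff_pf` (RH `⇔ ξ₁ ∈ PF_∞`), proved in the tree (`katkova_rh_iff_pf_holds`:
Pólya's half + order `1/2` + `ξ(1/2) > 0` + Hadamard genus `0` + the entire case of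
Aissen–Schoenberg–Whitney–Edrei). [Katkova 2006, §1 Thm. C] [folklore] -/
theorem tpThesis_iff_riemannHypothesis : TpThesis ↔ Summit.RiemannHypothesis :=
  katkova_rh_iff_pf_holds.symm

/-- `RiemannHypothesis → TpThesis` (calibration direction, = the route's `TpConverse` content).
[Katkova 2006, §1 Thm. C] [folklore] -/
theorem tpThesis_of_riemannHypothesis (h : Summit.RiemannHypothesis) : TpThesis :=
  tpThesis_iff_riemannHypothesis.2 h

/-- `TpThesis → RiemannHypothesis` (assembly direction, = the route's `Assembly` content).
[Katkova 2006, §1 Thm. C] [folklore] -/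
theorem riemannHypothesis_of_tpThesis (h : TpThesis) : Summit.RiemannHypothesis :=
  tpThesis_iff_riemannHypothesis.1 h

/-- `TpThesis` says exactly that `(γ(n)/n!)ₙ` is a Pólya frequency sequence in the sense of
`Literature.Analysis.TotalPositivity.IsPolyaFrequencySeq` (the route's guarded-`ℕ`-subtraction
minor is `toeplitzMinor`, `xiToeplitzMinor_eq`). [folklore] -/
theorem tpThesis_iff_isPolyaFrequencySeq :
    TpThesis ↔ IsPolyaFrequencySeq (fun n => xiTaylorCoeff n / (n ! : ℝ)) := by
  rw [isPolyaFrequencySeq_xi_iff]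
  exact Iff.rfl

/-- `TpThesis ↔ ∀ m, (γ(n)/n!)ₙ ∈ PF_m` (`PF_∞ = ⋂ₘ PF_m`). [Katkova 2006, §1] [folklore] -/
theorem tpThesis_iff_forall_isMultiplyPositiveSeq :
    TpThesis ↔ ∀ m : ℕ, IsMultiplyPositiveSeq m (fun n => xiTaylorCoeff n / (n ! : ℝ)) := by
  rw [tpThesis_iff_isPolyaFrequencySeq, isPolyaFrequencySeq_iff_forall]

/-- **The finite approximants.** RH up to height `T` yields every instance of `TpThesis` of
order `k` with `k + 1 ≤ π T`: the zeros `(ρ - 1/2)²` of `ξ₁` then lie in `|arg w| ≥ π - 1/T`,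
and Schoenberg's sector theorem (Thm. B, proved in the tree) with Hadamard's genus-`0`
factorisation gives `PF_k` (`isMultiplyPositiveSeq_xi_of_riemannHypothesisUpTo`).
[Katkova 2006, remark after Thm. 1] [folklore] -/
theorem tpThesis_order_of_riemannHypothesisUpTo {T : ℝ} {k : ℕ} (hRH : RiemannHypothesisUpTo T)
    (hkT : (k : ℝ) + 1 ≤ Real.pi * T) (r c : Fin k → ℕ) (hr : StrictMono r) (hc : StrictMono c) :
    0 ≤ (Matrix.of fun i j : Fin k => if c j ≤ r i then
      xiTaylorCoeff (r i - c j) / ((r i - c j).factorial : ℝ) else 0).det := by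
  have h := isMultiplyPositiveSeq_xi_of_riemannHypothesisUpTo hRH hkT k le_rfl r c hr hc
  rw [← xiToeplitzMinor_eq] at h
  exact h

/-- **Unconditionally, every minor of order `k ≤ 49` is `≥ 0`** (`ξ₁ ∈ PF₄₉`,
`isMultiplyPositiveSeq_xi_fortyNine`, from the kernel-checked certificate
`riemannHypothesisUpTo_sixteen` and `50 ≤ 16π`). In particular a counterexample to `TpThesis`
has order `≥ 50`. [Katkova 2006, Thm. 1 and the remark after it] [folklore] -/
theorem tpThesis_order_le_fortyNine {k : ℕ} (hk : k ≤ 49) (r c : Fin k → ℕ) (hr : StrictMono r)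
    (hc : StrictMono c) :
    0 ≤ (Matrix.of fun i j : Fin k => if c j ≤ r i then
      xiTaylorCoeff (r i - c j) / ((r i - c j).factorial : ℝ) else 0).det := by
  have h := isMultiplyPositiveSeq_xi_fortyNine k hk r c hr hc
  rw [← xiToeplitzMinor_eq] at h
  exact h

/-- If RH holds up to every height then `TpThesis` holds, assembled from the finite
approximants alone (order `k` from height `(k + 1)/π`), without passing through
`katkova_rh_iff_pf_holds`. [Katkova 2006, remark after Thm. 1] [folklore] -/
theorem tpThesis_of_forall_riemannHypothesisUpTo (h : ∀ T : ℝ, RiemannHypothesisUpTo T) :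
    TpThesis := by
  intro k r c hr hc
  exact tpThesis_order_of_riemannHypothesisUpTo (T := ((k : ℝ) + 1) / Real.pi) (h _)
    (le_of_eq (by field_simp)) r c hr hc

/-- **`TpThesis ↔ ∀ T, RiemannHypothesisUpTo T`**: the item is the passage to the limit
`T → ∞` in the numerical verifications of RH (`←`: the finite approximants; `→`: `TpThesis` is
RH, and RH controls every height). [folklore] -/
theorem tpThesis_iff_forall_riemannHypothesisUpTo :
    TpThesis ↔ ∀ T : ℝ, RiemannHypothesisUpTo T :=
  ⟨fun h T => RiemannHypothesisUpTo.of_riemannHypothesis (riemannHypothesis_of_tpThesis h) T,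
    tpThesis_of_forall_riemannHypothesisUpTo⟩

/-- The route's Σ₁ negative side `TpNegativeCertificate` (a single negative minor) is literally
the negation of `TpThesis`. [folklore] -/
theorem tpThesis_iff_not_tpNegativeCertificate : TpThesis ↔ ¬ TpNegativeCertificate := by
  unfold TpThesis TpNegativeCertificate
  simp only [not_exists, not_and, not_lt]

/-- Hence a negative minor refutes RH (and, by `tpThesis_order_le_fortyNine`, must have order
`≥ 50`). [folklore] -/
theorem not_riemannHypothesis_of_tpNegativeCertificate (h : TpNegativeCertificate) :
    ¬ Summit.RiemannHypothesis := fun hRH =>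
  (tpThesis_iff_not_tpNegativeCertificate.1 (tpThesis_of_riemannHypothesis hRH)) h

/-- `TpThesis` contains the order-`3` item `TpOrderThree` as an instance. [folklore] -/
theorem tpOrderThree_of_tpThesis (h : TpThesis) : TpOrderThree :=
  fun r c hr hc => h 3 r c hr hc

end Summit.RiemannHypothesis.TotalPositivity

end
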